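import Summits.NavierStokesRegularity.NavierStokesRegularity.Theorems.ExtremiserTransienceLocalMaximiserZoom
import Summits.NavierStokesRegularity.NavierStokesRegularity.Theorems.ExtremiserTransienceLocalMaximiserGainLimit
import Summits.NavierStokesRegularity.NavierStokesRegularity.Theorems.ExtremiserTransienceTwoThirdsDefs
import Mathlib.MeasureTheory.Measure.Lebesgue.EqHaar
import HarnessLib

/-!
# Route `ExtremiserTransience`, crux `NearExtremalTransiencePerFlow` (stmt-NavierStokesRegularity-26567),
# LINE g10-1 `two_thirds` (ns-idea-10 g10): BALL CALCULUS for S1b `ExtremalExtraction` (groundwork)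

`--supports stmt-NavierStokesRegularity-26567 --as helper`.  Over the texts of record `…TwoThirdsDefs` (p719439: `Jb Zb Wb IsGoodBall
IsDoubling IsGoodBallAt …`) and the landed L3 zoom / gain-limit calculus (`…LocalMaximiserZoom`, `…LocalMaximiserGainLimit`), this
file supplies the three pieces of bookkeeping the S1b card names («the three clauses of `IsGoodBallAt` are closed under the `C²_loc`
convergence of the normalised slices and continuity of `(c,r) ↦ ∫_{B(c,r)}`; `b₀ ≤ Z_B` from thickness; doubling at infinitely many
scales by counting 4-adic steps»):

* §1–§3 ZOOM: `setIntegral_ball_comp_affine`; `Zb/Wb/Jb_azoom`; in cell units `Z_B(v; x₀+λc, rλ) = M²λ·Z_B(V; c, r)`,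
  `W_B = M²λ⁻¹·W_B(V)`, `J_B = M³·J_B(V)` for `V = azoom M⁻¹ λ x₀ v`, whence
  `isGoodBallAt_iff_isGoodBall_azoom : IsGoodBallAt v M λ (x₀ + λ•c) r δ ↔ IsGoodBall V c r δ` and the centre bookkeeping;
* §4 LIMIT: `tendsto_setIntegral_ball` (moving-ball dominated convergence; spheres are null, `Measure.addHaar_sphere`),
  `tendsto_ballFunctionals` (the three functionals along pointwise-convergent smooth fields with uniform derivative budgets and
  convergent centres/radii), `isGoodBall_of_limit` (closedness of the three clauses, fixed tolerance);
* §5 LIMIT-SIDE FACTS: `Zb_mono`/`Wb_mono`, `setIntegral_ball_le_of_le`, `volume_real_ball_eq` (`vol B(c,ρ) = ρ³ vol B(0,1)`),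
  `Zb_half_pos` (thickness `‖curl V 0‖ ≥ θ` + Lipschitz vorticity ⇒ `Z_{B(0,1/2)} > 0`), and the 4-adic count
  `exists_three_step_ratio_le` (`0 < b ≤ β j ≤ K·64^j` monotone-free ⇒ `β(i+2) ≤ 4^{10} β(i−1)` for infinitely many `i`).

HONEST FRAMING: calculus only; S1a/S1b/S2, the crux ⟨26567⟩ and NS regularity are OPEN; nothing about Navier–Stokes regularity or
blow-up is proved; no summit is proved by a line. [folklore]
-/

noncomputable section

open scoped Topology InnerProductSpace RealInnerProductSpace ENNReal ContDiff
open MeasureTheory Filter Set Metric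
open Literature.Analysis.FluidPDE
open Summit.NavierStokesRegularity.NavierStokesRegularity.Theorems.DepletionLadder.KStar.HalfSpace
open Summit.NavierStokesRegularity.NavierStokesRegularity.Theorems.DepletionLadder.KStar.BangBang
open Summit.NavierStokesRegularity.NavierStokesRegularity.Theorems.NearExtremalTransiencePerFlow.ZoneTransversality
open Summit.NavierStokesRegularity.NavierStokesRegularity.Theorems.NearExtremalTransiencePerFlow.LocalMaximiser

namespace Summit.NavierStokesRegularity.NavierStokesRegularity.Theorems.NearExtremalTransiencePerFlow.TwoThirds

-- the problem directory repeats the summit name (`NavierStokesRegularity/NavierStokesRegularity`)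
set_option linter.dupNamespace false

/-! ## §1 Change of variables on balls -/

variable {a b : ℝ} {x₀ : E3} {v : E3 → E3}

/-- `x₀ + b•x ∈ B(x₀ + b•c, b r) ↔ x ∈ B(c, r)` for `b > 0`. -/
theorem mem_ball_affine_iff (hb : 0 < b) (x₀ c x : E3) (r : ℝ) :
    x₀ + b • x ∈ Metric.ball (x₀ + b • c) (b * r) ↔ x ∈ Metric.ball c r := by
  rw [Metric.mem_ball, Metric.mem_ball, dist_eq_norm, dist_eq_norm, add_sub_add_left_eq_sub, ← smul_sub, norm_smul,
    Real.norm_eq_abs, abs_of_pos hb]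
  exact ⟨fun h => lt_of_mul_lt_mul_left h hb.le, fun h => mul_lt_mul_of_pos_left h hb⟩

/-- Change of variables `x ↦ x₀ + b•x` (`b > 0`) on a ball: `∫_{B(c,r)} f(x₀ + b x) dx = b⁻³ ∫_{B(x₀ + b c, b r)} f`. -/
theorem setIntegral_ball_comp_affine (hb : 0 < b) (x₀ c : E3) (r : ℝ) (f : E3 → ℝ) :
    ∫ x in Metric.ball c r, f (x₀ + b • x) = (b ^ 3)⁻¹ * ∫ z in Metric.ball (x₀ + b • c) (b * r), f z := by
  rw [← integral_indicator measurableSet_ball, ← integral_indicator measurableSet_ball]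
  have e : (Metric.ball c r).indicator (fun x => f (x₀ + b • x)) =
      fun x => (Metric.ball (x₀ + b • c) (b * r)).indicator f (x₀ + b • x) := by
    funext x
    by_cases hx : x ∈ Metric.ball c r
    · rw [Set.indicator_of_mem hx, Set.indicator_of_mem ((mem_ball_affine_iff hb x₀ c x r).2 hx)]
    · rw [Set.indicator_of_notMem hx, Set.indicator_of_notMem (fun h => hx ((mem_ball_affine_iff hb x₀ c x r).1 h))]
  rw [e, integral_comp_affine_three hb x₀]

/-! ## §2 The ball functionals under `azoom a b x₀ v = a • v(x₀ + b•x)` -/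

/-- `Z_B` under the affine zoom. -/
theorem Zb_azoom (hb : 0 < b) (c : E3) (r : ℝ) :
    Zb (azoom a b x₀ v) c r = (a * b) ^ 2 * (b ^ 3)⁻¹ * Zb v (x₀ + b • c) (b * r) := by
  unfold Zb
  simp_rw [zd_azoom]
  rw [integral_const_mul, setIntegral_ball_comp_affine hb x₀ c r (zd v)]
  ring

/-- `W_B` under the affine zoom. -/
theorem Wb_azoom (hb : 0 < b) (c : E3) (r : ℝ) :
    Wb (azoom a b x₀ v) c r = (a * b * b) ^ 2 * (b ^ 3)⁻¹ * Wb v (x₀ + b • c) (b * r) := by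
  unfold Wb
  simp_rw [wd_azoom]
  rw [integral_const_mul, setIntegral_ball_comp_affine hb x₀ c r (wd v)]
  ring

/-- `J_B` under the affine zoom. -/
theorem Jb_azoom (hb : 0 < b) (c : E3) (r : ℝ) :
    Jb (azoom a b x₀ v) c r = (a * b) ^ 3 * (b ^ 3)⁻¹ * Jb v (x₀ + b • c) (b * r) := by
  unfold Jb
  simp_rw [sd_azoom]
  rw [integral_const_mul, setIntegral_ball_comp_affine hb x₀ c r (sd v)]
  ring

/-! ## §3 Normalised zoom `a = M⁻¹`, `b = λ`: cell units -/

/-- `Z_B(v; x₀ + λc, rλ) = M²λ · Z_B(V; c, r)` for the normalised zoom `V = azoom M⁻¹ λ x₀ v`. -/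
theorem Zb_orig_eq {M lam' : ℝ} (hM : 0 < M) (hl : 0 < lam') (c : E3) (r : ℝ) :
    Zb v (x₀ + lam' • c) (r * lam') = M ^ 2 * lam' * Zb (azoom M⁻¹ lam' x₀ v) c r := by
  rw [Zb_azoom hl, mul_comm r lam']
  field_simp

/-- `W_B(v; x₀ + λc, rλ) = M²λ⁻¹ · W_B(V; c, r)`. -/
theorem Wb_orig_eq {M lam' : ℝ} (hM : 0 < M) (hl : 0 < lam') (c : E3) (r : ℝ) :
    Wb v (x₀ + lam' • c) (r * lam') = M ^ 2 * lam'⁻¹ * Wb (azoom M⁻¹ lam' x₀ v) c r := by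
  rw [Wb_azoom hl, mul_comm r lam']
  field_simp

/-- `J_B(v; x₀ + λc, rλ) = M³ · J_B(V; c, r)`. -/
theorem Jb_orig_eq {M lam' : ℝ} (hM : 0 < M) (hl : 0 < lam') (c : E3) (r : ℝ) :
    Jb v (x₀ + lam' • c) (r * lam') = M ^ 3 * Jb (azoom M⁻¹ lam' x₀ v) c r := by
  rw [Jb_azoom hl, mul_comm r lam']
  field_simp

/-- **Good balls in cell units.**  A good ball of the slice `v` (height `M`, Taylor length `λ`) at `x₀ + λc`, radius `r`
(Taylor units), tolerance `δ`, is exactly a good ball of the normalised zoom `azoom M⁻¹ λ x₀ v` at `(c, r)` with the same `δ`. -/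
theorem isGoodBallAt_iff_isGoodBall_azoom {M lam' : ℝ} (hM : 0 < M) (hl : 0 < lam') (c : E3) (r δ : ℝ) :
    IsGoodBallAt v M lam' (x₀ + lam' • c) r δ ↔ IsGoodBall (azoom M⁻¹ lam' x₀ v) c r δ := by
  unfold IsGoodBallAt IsGoodBall
  have hZ0 : 0 ≤ Zb (azoom M⁻¹ lam' x₀ v) c r := Zb_nonneg _ _ _
  have hW0 : 0 ≤ Wb (azoom M⁻¹ lam' x₀ v) c r := Wb_nonneg _ _ _
  rw [Zb_orig_eq hM hl c r, Wb_orig_eq hM hl c r, Jb_orig_eq hM hl c r, Zb_orig_eq hM hl c (r + r ^ (7 / 8 : ℝ)),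
    Wb_orig_eq hM hl c (r + r ^ (7 / 8 : ℝ))]
  generalize Zb (azoom M⁻¹ lam' x₀ v) c r = Z at hZ0 ⊢
  generalize Wb (azoom M⁻¹ lam' x₀ v) c r = W at hW0 ⊢
  generalize Jb (azoom M⁻¹ lam' x₀ v) c r = J
  generalize Zb (azoom M⁻¹ lam' x₀ v) c (r + r ^ (7 / 8 : ℝ)) = Z'
  generalize Wb (azoom M⁻¹ lam' x₀ v) c (r + r ^ (7 / 8 : ℝ)) = W'
  have hs : 0 < M ^ 2 * lam' := by positivity
  have hM3 : 0 < M ^ 3 := by positivity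
  have hlne : lam' ≠ 0 := hl.ne'
  -- the three identities
  have e1 : kStar * M * Real.sqrt (M ^ 2 * lam' * Z * (M ^ 2 * lam'⁻¹ * W)) * (1 - δ) =
      M ^ 3 * (kStar * Real.sqrt (Z * W) * (1 - δ)) := by
    have e : M ^ 2 * lam' * Z * (M ^ 2 * lam'⁻¹ * W) = (M ^ 2) ^ 2 * (Z * W) := by field_simp
    rw [e, Real.sqrt_mul (by positivity), Real.sqrt_sq (by positivity)]
    ring
  have e2 : lam' ^ 2 * (M ^ 2 * lam'⁻¹ * W) - M ^ 2 * lam' * Z = (M ^ 2 * lam') * (W - Z) := by field_simp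
  have e2' : δ * (M ^ 2 * lam' * Z) = (M ^ 2 * lam') * (δ * Z) := by ring
  have e3 : M ^ 2 * lam' * Z' + lam' ^ 2 * (M ^ 2 * lam'⁻¹ * W') - (M ^ 2 * lam' * Z + lam' ^ 2 * (M ^ 2 * lam'⁻¹ * W)) =
      (M ^ 2 * lam') * (Z' + W' - (Z + W)) := by field_simp
  have e3' : δ * (M ^ 2 * lam' * Z + lam' ^ 2 * (M ^ 2 * lam'⁻¹ * W)) = (M ^ 2 * lam') * (δ * (Z + W)) := by field_simp
  rw [e1, e2, e2', e3, e3', abs_mul, abs_of_pos hs]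
  constructor
  · rintro ⟨h1, h2, h3⟩
    exact ⟨le_of_mul_le_mul_left h1 hM3, le_of_mul_le_mul_left h2 hs, le_of_mul_le_mul_left h3 hs⟩
  · rintro ⟨h1, h2, h3⟩
    exact ⟨mul_le_mul_of_nonneg_left h1 hM3.le, mul_le_mul_of_nonneg_left h2 hs.le, mul_le_mul_of_nonneg_left h3 hs.le⟩

/-- The direction used by the extraction: a slice-level good ball is a good ball of the normalised zoom. -/
theorem isGoodBall_azoom_of_isGoodBallAt {M lam' : ℝ} (hM : 0 < M) (hl : 0 < lam') {c : E3} {r δ : ℝ}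
    (h : IsGoodBallAt v M lam' c r δ) : IsGoodBall (azoom M⁻¹ lam' x₀ v) (lam'⁻¹ • (c - x₀)) r δ := by
  have e : x₀ + lam' • (lam'⁻¹ • (c - x₀)) = c := by
    rw [smul_smul, mul_inv_cancel₀ hl.ne', one_smul, add_sub_cancel]
  rw [← isGoodBallAt_iff_isGoodBall_azoom hM hl, e]
  exact h

/-- Centres: `dist c x₀ ≤ rλ/2` becomes `‖λ⁻¹(c − x₀)‖ ≤ r/2` in cell units. -/
theorem norm_cell_centre_le {lam' : ℝ} (hl : 0 < lam') {c : E3} {r : ℝ} (h : dist c x₀ ≤ r * lam' / 2) :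
    ‖lam'⁻¹ • (c - x₀)‖ ≤ r / 2 := by
  rw [norm_smul, Real.norm_eq_abs, abs_of_pos (inv_pos.2 hl), ← dist_eq_norm, inv_mul_le_iff₀ hl]
  linarith

/-! ## §4 Ball integrals along convergent fields, centres and radii -/

/-- A ball with centre of norm `≤ Rc` and radius `≤ Rρ` lies in `B(0, Rc + Rρ)`. -/
theorem ball_subset_ball_zero {d : E3} {s Rc Rρ : ℝ} (hd : ‖d‖ ≤ Rc) (hs : s ≤ Rρ) :
    Metric.ball d s ⊆ Metric.ball (0 : E3) (Rc + Rρ) := by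
  intro x hx
  rw [Metric.mem_ball, dist_eq_norm] at hx
  rw [Metric.mem_ball, dist_zero_right]
  calc ‖x‖ = ‖(x - d) + d‖ := by rw [sub_add_cancel]
    _ ≤ ‖x - d‖ + ‖d‖ := norm_add_le _ _
    _ < Rc + Rρ := by linarith

/-- **Moving-ball dominated convergence.**  If `g_k → g` pointwise with a uniform bound, `c_k → c`, `ρ_k → ρ` (centres and
radii bounded), then `∫_{B(c_k,ρ_k)} g_k → ∫_{B(c,ρ)} g` (the sphere `{dist · c = ρ}` is Lebesgue-null). -/
theorem tendsto_setIntegral_ball {g : ℕ → E3 → ℝ} {g' : E3 → ℝ} {c : ℕ → E3} {c' : E3} {ρ : ℕ → ℝ} {ρ' K Rc Rρ : ℝ}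
    (hmeas : ∀ k, AEStronglyMeasurable (g k) volume) (hbd : ∀ k x, ‖g k x‖ ≤ K)
    (hlim : ∀ x, Tendsto (fun k => g k x) atTop (𝓝 (g' x)))
    (hc : Tendsto c atTop (𝓝 c')) (hρ : Tendsto ρ atTop (𝓝 ρ'))
    (hcb : ∀ k, ‖c k‖ ≤ Rc) (hρb : ∀ k, ρ k ≤ Rρ) :
    Tendsto (fun k => ∫ x in Metric.ball (c k) (ρ k), g k x) atTop (𝓝 (∫ x in Metric.ball c' ρ', g' x)) := by
  have hK : 0 ≤ K := (norm_nonneg _).trans (hbd 0 0)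
  simp_rw [← integral_indicator measurableSet_ball]
  refine tendsto_integral_of_dominated_convergence (fun x => (Metric.ball (0 : E3) (Rc + Rρ)).indicator (fun _ => K) x)
    (fun k => (hmeas k).indicator measurableSet_ball) ?_ (fun k => Eventually.of_forall fun x => ?_) ?_
  · rw [integrable_indicator_iff measurableSet_ball]
    exact integrableOn_const (measure_ball_lt_top).ne
  · by_cases hx : x ∈ Metric.ball (c k) (ρ k)
    · rw [Set.indicator_of_mem hx, Set.indicator_of_mem (ball_subset_ball_zero (hcb k) (hρb k) hx)]
      exact hbd k x
    · rw [Set.indicator_of_notMem hx, norm_zero]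
      exact Set.indicator_nonneg (fun _ _ => hK) _
  · have h0 : (volume : Measure E3) (Metric.sphere c' ρ') = 0 := Measure.addHaar_sphere volume c' ρ'
    have hs : ∀ᵐ x ∂(volume : Measure E3), x ∉ Metric.sphere c' ρ' := by
      rw [ae_iff]; simpa only [not_not, Set.setOf_mem_eq] using h0
    filter_upwards [hs] with x hx
    rw [Metric.mem_sphere] at hx
    have hd : Tendsto (fun k => dist x (c k) - ρ k) atTop (𝓝 (dist x c' - ρ')) :=
      (tendsto_const_nhds.dist hc).sub hρ
    rcases lt_or_gt_of_ne hx with h | h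
    · have hev : ∀ᶠ k in atTop, x ∈ Metric.ball (c k) (ρ k) := by
        filter_upwards [hd.eventually (Iio_mem_nhds (show dist x c' - ρ' < 0 by linarith))] with k hk
        rw [Metric.mem_ball]; linarith
      rw [Set.indicator_of_mem (show x ∈ Metric.ball c' ρ' from h)]
      refine (hlim x).congr' ?_
      filter_upwards [hev] with k hk
      rw [Set.indicator_of_mem hk]
    · have hev : ∀ᶠ k in atTop, x ∉ Metric.ball (c k) (ρ k) := by
        filter_upwards [hd.eventually (Ioi_mem_nhds (show 0 < dist x c' - ρ' by linarith))] with k hk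
        rw [Metric.mem_ball, not_lt]; linarith
      rw [Set.indicator_of_notMem (show x ∉ Metric.ball c' ρ' from fun h' => by rw [Metric.mem_ball] at h'; linarith)]
      refine tendsto_const_nhds.congr' ?_
      filter_upwards [hev] with k hk
      rw [Set.indicator_of_notMem hk]

variable {Fn : ℕ → E3 → E3} {F : E3 → E3}

/-- **The three ball functionals pass to the limit** along a `C²_loc`-convergent sequence of smooth fields with uniform
derivative budgets (pointwise convergence + bounds, as in `LocalMaximiser.tendsto_sd_zd_wd_of_bounds`) and convergent centres/radii. -/
theorem tendsto_ballFunctionals (hFn : ∀ n, ContDiff ℝ (⊤ : ℕ∞) (Fn n)) (hF : ContDiff ℝ (⊤ : ℕ∞) F)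
    (hb : ∀ k : ℕ, ∃ C : ℝ, (∀ n x, ‖iteratedFDeriv ℝ k (Fn n) x‖ ≤ C) ∧ ∀ x, ‖iteratedFDeriv ℝ k F x‖ ≤ C)
    (hpt : ∀ x, Tendsto (fun n => Fn n x) atTop (𝓝 (F x)))
    {c : ℕ → E3} {c' : E3} {ρ : ℕ → ℝ} {ρ' Rc Rρ : ℝ} (hc : Tendsto c atTop (𝓝 c')) (hρ : Tendsto ρ atTop (𝓝 ρ'))
    (hcb : ∀ k, ‖c k‖ ≤ Rc) (hρb : ∀ k, ρ k ≤ Rρ) :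
    Tendsto (fun n => Jb (Fn n) (c n) (ρ n)) atTop (𝓝 (Jb F c' ρ')) ∧
      Tendsto (fun n => Zb (Fn n) (c n) (ρ n)) atTop (𝓝 (Zb F c' ρ')) ∧
      Tendsto (fun n => Wb (Fn n) (c n) (ρ n)) atTop (𝓝 (Wb F c' ρ')) := by
  obtain ⟨B₁, hB₁n, -⟩ := hb 1
  obtain ⟨B₂, hB₂n, -⟩ := hb 2
  have hbd := fun n x => sd_zd_wd_bounds (hFn n) (hB₁n n) (hB₂n n) x
  have hl := fun x => tendsto_sd_zd_wd_of_bounds hFn hF hb hpt x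
  refine ⟨?_, ?_, ?_⟩
  · exact tendsto_setIntegral_ball (K := 16 * B₁ ^ 3) (fun n => (continuous_sd' (hFn n)).aestronglyMeasurable)
      (fun n x => by rw [Real.norm_eq_abs]; exact (hbd n x).1) (fun x => (hl x).1) hc hρ hcb hρb
  · exact tendsto_setIntegral_ball (K := 16 * B₁ ^ 2) (fun n => (continuous_zd' (hFn n)).aestronglyMeasurable)
      (fun n x => by rw [Real.norm_eq_abs, abs_of_nonneg (show 0 ≤ zd (Fn n) x from sq_nonneg _)]; exact (hbd n x).2.1)
      (fun x => (hl x).2.1)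
      hc hρ hcb hρb
  · exact tendsto_setIntegral_ball (K := 48 * B₂ ^ 2) (fun n => (continuous_wd' (hFn n)).aestronglyMeasurable)
      (fun n x => by rw [Real.norm_eq_abs, abs_of_nonneg (show 0 ≤ wd (Fn n) x from frobeniusNormSq_nonneg _)]; exact (hbd n x).2.2)
      (fun x => (hl x).2.2) hc hρ hcb hρb

/-- `ρ^{7/8} ≤ max ρ 1` for `ρ ≥ 0`. -/
theorem rpow_seven_eighths_le {ρ : ℝ} (hρ : 0 ≤ ρ) : ρ ^ (7 / 8 : ℝ) ≤ max ρ 1 := by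
  rcases le_or_gt 1 ρ with h | h
  · exact (Real.rpow_le_rpow_of_exponent_le h (by norm_num : (7 / 8 : ℝ) ≤ 1)).trans (by rw [Real.rpow_one]; exact le_max_left _ _)
  · exact (Real.rpow_le_one hρ h.le (by norm_num)).trans (le_max_right _ _)

/-- **Good balls are closed under the limit**: if every `Fn n` has a good ball at `(c n, ρ n)` with a fixed tolerance `δ`, the
fields converge as in `tendsto_ballFunctionals` and `(c n, ρ n) → (c, ρ)` with `ρ > 0`, then `F` has a good ball at `(c, ρ)`. -/
theorem isGoodBall_of_limit (hFn : ∀ n, ContDiff ℝ (⊤ : ℕ∞) (Fn n)) (hF : ContDiff ℝ (⊤ : ℕ∞) F)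
    (hb : ∀ k : ℕ, ∃ C : ℝ, (∀ n x, ‖iteratedFDeriv ℝ k (Fn n) x‖ ≤ C) ∧ ∀ x, ‖iteratedFDeriv ℝ k F x‖ ≤ C)
    (hpt : ∀ x, Tendsto (fun n => Fn n x) atTop (𝓝 (F x)))
    {c : ℕ → E3} {c' : E3} {ρ : ℕ → ℝ} {ρ' Rc Rρ δ : ℝ} (hc : Tendsto c atTop (𝓝 c')) (hρ : Tendsto ρ atTop (𝓝 ρ'))
    (hcb : ∀ k, ‖c k‖ ≤ Rc) (hρb : ∀ k, ρ k ≤ Rρ) (hρ0 : ∀ k, 0 ≤ ρ k)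
    (hgood : ∀ n, IsGoodBall (Fn n) (c n) (ρ n) δ) : IsGoodBall F c' ρ' δ := by
  obtain ⟨hJ, hZ, hW⟩ := tendsto_ballFunctionals hFn hF hb hpt hc hρ hcb hρb
  -- the outer radius `ρ + ρ^{7/8}`
  have hρ2 : Tendsto (fun n => ρ n + ρ n ^ (7 / 8 : ℝ)) atTop (𝓝 (ρ' + ρ' ^ (7 / 8 : ℝ))) :=
    hρ.add (hρ.rpow_const (Or.inr (by norm_num)))
  have hρ2b : ∀ k, ρ k + ρ k ^ (7 / 8 : ℝ) ≤ Rρ + max Rρ 1 := fun k =>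
    add_le_add (hρb k) ((rpow_seven_eighths_le (hρ0 k)).trans (max_le_max (hρb k) le_rfl))
  obtain ⟨-, hZ2, hW2⟩ := tendsto_ballFunctionals hFn hF hb hpt hc hρ2 hcb hρ2b
  refine ⟨?_, ?_, ?_⟩
  · exact le_of_tendsto_of_tendsto' ((tendsto_const_nhds.mul ((hZ.mul hW).sqrt)).mul tendsto_const_nhds) hJ
      fun n => (hgood n).1
  · exact le_of_tendsto_of_tendsto' ((hW.sub hZ).abs) (tendsto_const_nhds.mul hZ) fun n => (hgood n).2.1
  · exact le_of_tendsto_of_tendsto' ((hZ2.add hW2).sub (hZ.add hW)) (tendsto_const_nhds.mul (hZ.add hW))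
      fun n => (hgood n).2.2

/-! ## §5 Limit-side facts: monotonicity in the ball, positivity from thickness, the 4-adic doubling count -/

/-- `Z_B` is monotone in the ball (smooth field). -/
theorem Zb_mono {V : E3 → E3} (hV : ContDiff ℝ (⊤ : ℕ∞) V) {c c' : E3} {r r' : ℝ}
    (h : Metric.ball c r ⊆ Metric.ball c' r') : Zb V c r ≤ Zb V c' r' := by
  unfold Zb
  exact setIntegral_mono_set
    (((continuous_zd' hV).continuousOn.integrableOn_compact (isCompact_closedBall c' r')).mono_set Metric.ball_subset_closedBall)
    (Eventually.of_forall fun x => sq_nonneg _) (Eventually.of_forall h)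

/-- `W_B` is monotone in the ball (smooth field). -/
theorem Wb_mono {V : E3 → E3} (hV : ContDiff ℝ (⊤ : ℕ∞) V) {c c' : E3} {r r' : ℝ}
    (h : Metric.ball c r ⊆ Metric.ball c' r') : Wb V c r ≤ Wb V c' r' := by
  unfold Wb
  exact setIntegral_mono_set
    (((continuous_wd' hV).continuousOn.integrableOn_compact (isCompact_closedBall c' r')).mono_set Metric.ball_subset_closedBall)
    (Eventually.of_forall fun x => frobeniusNormSq_nonneg _) (Eventually.of_forall h)

/-- Upper bound of a ball integral of a continuous density bounded by `K`: `≤ K · vol B(c,ρ)`. -/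
theorem setIntegral_ball_le_of_le {g : E3 → ℝ} {K : ℝ} (hg : ∀ x, g x ≤ K) (hgi : Continuous g) (c : E3) (ρ : ℝ) :
    ∫ x in Metric.ball c ρ, g x ≤ K * (volume : Measure E3).real (Metric.ball c ρ) := by
  have hfin : (volume : Measure E3) (Metric.ball c ρ) < ⊤ := measure_ball_lt_top
  calc ∫ x in Metric.ball c ρ, g x ≤ ∫ _ in Metric.ball c ρ, K :=
        setIntegral_mono_on ((hgi.continuousOn.integrableOn_compact (isCompact_closedBall c ρ)).mono_set Metric.ball_subset_closedBall)
          (integrableOn_const hfin.ne) measurableSet_ball fun x _ => hg x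
    _ = K * (volume : Measure E3).real (Metric.ball c ρ) := by rw [setIntegral_const, smul_eq_mul, mul_comm]

/-- Volume of a ball in `ℝ³`: `vol B(c,ρ) = ρ³ · vol B(0,1)` (`ρ ≥ 0`). -/
theorem volume_real_ball_eq (c : E3) {ρ : ℝ} (hρ : 0 ≤ ρ) :
    (volume : Measure E3).real (Metric.ball c ρ) = ρ ^ 3 * (volume : Measure E3).real (Metric.ball (0 : E3) 1) := by
  simp only [Measure.real]
  rw [Measure.addHaar_ball volume c hρ, ENNReal.toReal_mul, finrank_euclideanSpace, Fintype.card_fin,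
    ENNReal.toReal_ofReal (by positivity)]

/-- **Positivity from thickness**: if `‖curl V 0‖ ≥ θ > 0` and `‖D curl V‖ ≤ L`, then `Z_{B(0,1/2)} > 0`. -/
theorem Zb_half_pos {V : E3 → E3} (hV : ContDiff ℝ (⊤ : ℕ∞) V) {θ L : ℝ} (hθ : 0 < θ) (hL : 0 ≤ L)
    (h0 : θ ≤ ‖curl V 0‖) (hLip : ∀ x, ‖fderiv ℝ (curl V) x‖ ≤ L) : 0 < Zb V 0 (1 / 2) := by
  -- on `B(0, ρ₀)`, `ρ₀ = min (1/2) (θ/(2(L+1)))`, the vorticity is `≥ θ/2`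
  obtain ⟨ρ₀, hρ₀⟩ : ∃ ρ₀ : ℝ, ρ₀ = min (1 / 2) (θ / (2 * (L + 1))) := ⟨_, rfl⟩
  have hρ₀pos : 0 < ρ₀ := by rw [hρ₀]; exact lt_min (by norm_num) (by positivity)
  have hρ₀half : ρ₀ ≤ 1 / 2 := by rw [hρ₀]; exact min_le_left _ _
  have hρ₀θ : ρ₀ * (L + 1) ≤ θ / 2 := by
    have : ρ₀ ≤ θ / (2 * (L + 1)) := by rw [hρ₀]; exact min_le_right _ _
    rw [le_div_iff₀ (by positivity)] at this; linarith
  have hlow : ∀ x ∈ Metric.ball (0 : E3) ρ₀, (θ / 2) ^ 2 ≤ zd V x := by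
    intro x hx
    rw [Metric.mem_ball, dist_zero_right] at hx
    -- mean value: `‖curl V x − curl V 0‖ ≤ L‖x‖`
    have hcd : Differentiable ℝ (curl V) := (contDiff_curl (n := ⊤) hV).differentiable (by simp)
    have hmv : ‖curl V x - curl V 0‖ ≤ L * ‖x - 0‖ :=
      convex_univ.norm_image_sub_le_of_norm_fderiv_le (fun y _ => hcd y) (fun y _ => hLip y) (Set.mem_univ _) (Set.mem_univ _)
    rw [sub_zero] at hmv
    have h1 : θ / 2 ≤ ‖curl V x‖ := by
      have h2 : L * ‖x‖ ≤ θ / 2 := by nlinarith [hx, hL, hρ₀θ, norm_nonneg x]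
      have h3 : ‖curl V 0‖ ≤ ‖curl V x‖ + ‖curl V x - curl V 0‖ := by
        calc ‖curl V 0‖ = ‖curl V x - (curl V x - curl V 0)‖ := by rw [sub_sub_cancel]
          _ ≤ ‖curl V x‖ + ‖curl V x - curl V 0‖ := norm_sub_le _ _
      linarith
    unfold zd
    exact pow_le_pow_left₀ (by positivity) h1 2
  have hvol : 0 < (volume : Measure E3).real (Metric.ball (0 : E3) ρ₀) :=
    ENNReal.toReal_pos (Metric.measure_ball_pos volume 0 hρ₀pos).ne' measure_ball_lt_top.ne
  calc 0 < (θ / 2) ^ 2 * (volume : Measure E3).real (Metric.ball (0 : E3) ρ₀) := by positivity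
    _ = ∫ _ in Metric.ball (0 : E3) ρ₀, (θ / 2) ^ 2 := by rw [setIntegral_const, smul_eq_mul, mul_comm]
    _ ≤ Zb V 0 ρ₀ := by
        unfold Zb
        exact setIntegral_mono_on (integrableOn_const measure_ball_lt_top.ne)
          (((continuous_zd' hV).continuousOn.integrableOn_compact (isCompact_closedBall 0 ρ₀)).mono_set Metric.ball_subset_closedBall)
          measurableSet_ball fun x hx => hlow x hx
    _ ≤ Zb V 0 (1 / 2) := Zb_mono hV (Metric.ball_subset_ball hρ₀half)

/-- **The 4-adic doubling count** (pure real bookkeeping).  A monotone sequence `β` with `0 < b ≤ β j ≤ K·64^j` satisfies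
`β(i+2) ≤ 4^{10}·β(i−1)` for infinitely many `i ≥ 1`. -/
theorem exists_three_step_ratio_le {β : ℕ → ℝ} {b K : ℝ} (hb : 0 < b) (hlow : ∀ j, b ≤ β j) (hup : ∀ j, β j ≤ K * 64 ^ j)
    (i₀ : ℕ) : ∃ i : ℕ, i₀ ≤ i ∧ 1 ≤ i ∧ β (i + 2) ≤ 4 ^ 10 * β (i - 1) := by
  by_contra hno
  push Not at hno
  set i₁ : ℕ := max i₀ 1 with hi₁
  have hi₁0 : i₀ ≤ i₁ := le_max_left _ _
  have hi₁1 : 1 ≤ i₁ := le_max_right _ _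
  -- geometric growth along the arithmetic progression `i₁ − 1 + 3j`
  have hgrow : ∀ j : ℕ, (4 : ℝ) ^ (10 * j) * b ≤ β (i₁ - 1 + 3 * j) := by
    intro j
    induction j with
    | zero => simpa using hlow (i₁ - 1)
    | succ j ih =>
      have h := hno (i₁ + 3 * j) (by omega) (by omega)
      have e1 : i₁ + 3 * j - 1 = i₁ - 1 + 3 * j := by omega
      have e2 : i₁ + 3 * j + 2 = i₁ - 1 + 3 * (j + 1) := by omega
      rw [e1] at h; rw [e2] at h
      calc (4 : ℝ) ^ (10 * (j + 1)) * b = 4 ^ 10 * (4 ^ (10 * j) * b) := by ring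
        _ ≤ 4 ^ 10 * β (i₁ - 1 + 3 * j) := by nlinarith [ih]
        _ ≤ β (i₁ - 1 + 3 * (j + 1)) := h.le
  -- against the cubic bound: `4^{10j} b ≤ K 64^{i₁−1} (4^9)^j`, i.e. `4^j ≤ K 64^{i₁−1}/b`
  have hK : ∀ j : ℕ, (4 : ℝ) ^ j ≤ K * 64 ^ (i₁ - 1) / b := by
    intro j
    have h := (hgrow j).trans (hup (i₁ - 1 + 3 * j))
    have e : (64 : ℝ) ^ (i₁ - 1 + 3 * j) = 64 ^ (i₁ - 1) * 4 ^ (9 * j) := by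
      rw [pow_add, show (64 : ℝ) = 4 ^ 3 by norm_num, ← pow_mul, ← pow_mul]; ring_nf
    rw [e] at h
    rw [le_div_iff₀ hb]
    have h49 : (0 : ℝ) < 4 ^ (9 * j) := by positivity
    have e2 : (4 : ℝ) ^ (10 * j) = 4 ^ (9 * j) * 4 ^ j := by rw [← pow_add]; ring_nf
    rw [e2] at h
    nlinarith [h, h49]
  obtain ⟨j, hj⟩ := pow_unbounded_of_one_lt (K * 64 ^ (i₁ - 1) / b) (by norm_num : (1 : ℝ) < 4)
  exact absurd (hK j) (not_le.2 hj)

end Summit.NavierStokesRegularity.NavierStokesRegularity.Theorems.NearExtremalTransiencePerFlow.TwoThirds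

end
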